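import Literature.NumberTheory.EllipticCurves.BurungaleSkinner2023.X011TwistsCertificateProofs
import Literature.NumberTheory.GaloisRepresentations.IntegralGaloisActionProofs
import HarnessLib

/-!
# Burungale–Skinner 2023, Theorem 2.11 for `X₀(11)`: infinitely many quadratic twists of `X₀(11)`
# with `rank = ord_{s=1} L = 1` and non-degenerate `5`-adic height, modulo Thm. 2.11 BY NAME

A. Burungale, C. Skinner, Proc. AMS Ser. B 10 (2023), Thm. 2.11 (pp. 23–24) and Example (E4)
(p. 24): for `E = X₀(11) = 11A1` (`N = 11` odd, `5 ∤ N`), `Φ = ⟨T̄'⟩` the rational `5`-torsion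
line (`ϕ = 1`: order `∣ 2`, even, unramified at `5`), `ℓ₀ = 11 ∈ S` (split multiplicative),
`r_{11} = 1`, the hypotheses (i)–(iii) of Thm. 2.11 read: (i) `N = 11` is odd and there is no prime
`ℓ ≠ ℓ₀` dividing `N`; (ii) `ϕ(11) = +1` and "`ℓ₀ ≢ −1 mod 5`" (`11 ≡ 1`), the `ϕ(ℓ₀) = −1` clause
being void because `Γ_ℚ` acts trivially on `Φ` and `Φ` has a point of order `5 ≠ 2`
(`not_lineFrobeniusNegatesAt_of_forall_smul_eq` — this uses the EXISTENCE of a Frobenius element of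
`Γ_ℚ` at a prime of `ℤ̄` above `11`, tree `exists_isArithFrobAt_of_mem_primesAbove_holds`);
(iii) void (`11 ∈ S`). All of this is KERNEL-CHECKED here (the curve-side facts are those of
`X011TwistsCertificateProofs.lean`), so that — granting the named fact
`thm211_infinitelyMany_twists_rankOne_nondegenerate` (Thm. 2.11 as printed) —
**infinitely many discriminants `d` of imaginary quadratic fields have `rank E^{(d)}(ℚ) =
ord_{s=1} L(E^{(d)}, s) = 1`, `λ = 1` and NON-DEGENERATE `5`-adic height on (every global minimal
model of) `E^{(d)}`** (`infinitelyMany_twists_curve11A1`). Theorems only; no new facts.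

References: [BurungaleSkinner2023] Thm. 2.11 (pp. 23–24), Example (E4) (p. 24);
[NeukirchANT1999] Ch. I §9 (Frobenius elements).
-/

noncomputable section

open scoped Classical

open NumberField IsDedekindDomain IsDedekindDomain.HeightOneSpectrum WeierstrassCurve
  Literature.NumberTheory.EllipticCurves Literature.NumberTheory.EllipticCurves.Rank1Residual
  Literature.NumberTheory.EllipticCurves.X1Eleven Literature.NumberTheory.EllipticCurves.Curve11a
  Literature.NumberTheory.GaloisRepresentations

namespace Literature.NumberTheory.EllipticCurves.BurungaleSkinner2023

/-! ### `ϕ = 1` is not `−1` at any prime -/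

/-- The place of `𝓞_ℚ` above a rational prime `ℓ` (through Mathlib's `primesEquiv`) contains `ℓ`.
[folklore] -/
private theorem natCast_mem_primesEquiv_symm (ℓ : ℕ) (hℓ : ℓ.Prime) :
    (ℓ : 𝓞 ℚ) ∈ ((Rat.HeightOneSpectrum.primesEquiv (R := 𝓞 ℚ)).symm ⟨ℓ, hℓ⟩).asIdeal := by
  set v := (Rat.HeightOneSpectrum.primesEquiv (R := 𝓞 ℚ)).symm ⟨ℓ, hℓ⟩ with hv
  have hgen : Rat.HeightOneSpectrum.natGenerator v = ℓ :=
    congrArg Subtype.val ((Rat.HeightOneSpectrum.primesEquiv (R := 𝓞 ℚ)).apply_symm_apply ⟨ℓ, _⟩)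
  rw [← Ideal.apply_mem_of_equiv_iff (f := Rat.IsIntegralClosure.intEquiv (𝓞 ℚ)), map_natCast,
    ← Rat.HeightOneSpectrum.natGenerator_dvd_iff, hgen]

/-- **If `Γ_ℚ` acts trivially on the line `Φ` and `Φ` contains a point `P ≠ −P`, then `ϕ(ℓ) ≠ −1`
at every prime `ℓ`** (`¬ LineFrobeniusNegatesAt`): a Frobenius element `σ ∈ Γ_ℚ` at a prime of `ℤ̄`
above `ℓ` EXISTS (tree `primesAbove_nonempty`, `exists_isArithFrobAt_of_mem_primesAbove_holds`), and
it would give `P = σ P = −P`. [cite: BurungaleSkinner2023, remark after Lemma 2.3 (p. 17) ("ϕ = 1")] -/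
theorem not_lineFrobeniusNegatesAt_of_forall_smul_eq {W : WeierstrassCurve ℚ} {p : ℕ} [Fact p.Prime]
    {Φ : AddSubgroup (geomTorsion W (p : ℤ))}
    (hΦ : ∀ (σ : Field.absoluteGaloisGroup ℚ), ∀ P ∈ Φ, σ • P = P)
    {P : geomTorsion W (p : ℤ)} (hP : P ∈ Φ) (hP2 : P ≠ -P) {ℓ : ℕ} (hℓ : ℓ.Prime) :
    ¬ LineFrobeniusNegatesAt W p Φ ℓ := by
  intro hneg
  set v := (Rat.HeightOneSpectrum.primesEquiv (R := 𝓞 ℚ)).symm ⟨ℓ, hℓ⟩ with hv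
  have hmem : (ℓ : 𝓞 ℚ) ∈ v.asIdeal := natCast_mem_primesEquiv_symm ℓ hℓ
  obtain ⟨𝔓, h𝔓⟩ := v.primesAbove_nonempty
  obtain ⟨σ, hσ⟩ := exists_isArithFrobAt_of_mem_primesAbove_holds h𝔓
  have h1 := hneg v hmem 𝔓 h𝔓 σ hσ P hP
  rw [hΦ σ P hP] at h1
  exact hP2 h1

/-! ### Thm. 2.11 for `X₀(11)` -/

/-- **Infinitely many quadratic twists of `X₀(11)` with `rank = ord_{s=1} L = 1` and
non-degenerate `5`-adic height, modulo Thm. 2.11 by name.** All hypotheses of the named fact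
`thm211_infinitelyMany_twists_rankOne_nondegenerate` for `(X₀(11), Φ = ⟨T̄'⟩, ℓ₀ = 11)` are
kernel-checked: `5 ∤ N = 11`, `Φ` a rational line with `ϕ = 1`, `11 ∣ N`, `r_{11} = 1`
(`numPrimesAbove_five_eleven`), `11 ∉ A` (multiplicative), (i) `N` odd with no other prime factor,
(ii) `11 ≢ −1 (mod 5)` and `ϕ(11) ≠ −1`, (iii) void (`11` is split). Conclusion: the set of
discriminants `d` of imaginary quadratic fields with `TwistConclusion X₀(11) 5 d` is infinite.
[cite: BurungaleSkinner2023, Thm. 2.11 (pp. 23–24) and Example (E4) (p. 24)] -/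
theorem infinitelyMany_twists_curve11A1 [Fact (Nat.Prime 5)] [Fact (Nat.Prime 11)]
    (h : thm211_infinitelyMany_twists_rankOne_nondegenerate) :
    haveI := isGloballyMinimal_curve11A1
    {d : ℤ | IsOddQuadraticCharDiscr d ∧ TwistConclusion curve11A1 5 d}.Infinite := by
  haveI := isGloballyMinimal_curve11A1
  -- the line `Φ = ⟨T̄'⟩` with its generator
  set Tt : geomTorsion curve11A1 ((5 : ℕ) : ℤ) := ⟨T'bar, T'bar_mem_geomTorsion⟩ with hTt
  have hfix : ∀ σ : Field.absoluteGaloisGroup ℚ, σ • Tt = Tt := fun σ =>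
    Subtype.ext (smul_T'bar σ)
  have hord : addOrderOf Tt = 5 := by
    rw [← AddSubgroup.addOrderOf_coe]
    exact addOrderOf_T'bar
  set Φ : AddSubgroup (geomTorsion curve11A1 ((5 : ℕ) : ℤ)) := AddSubgroup.zmultiples Tt with hΦ
  have htriv : ∀ (σ : Field.absoluteGaloisGroup ℚ), ∀ P ∈ Φ, σ • P = P := by
    intro σ P hP
    obtain ⟨k, rfl⟩ := AddSubgroup.mem_zmultiples_iff.mp hP
    rw [smul_comm σ k Tt, hfix]
  have hcard : Nat.card Φ = 5 := by rw [hΦ, Nat.card_zmultiples, hord]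
  have hT2 : Tt ≠ -Tt := by
    intro h2
    have h0 : 2 • Tt = 0 := by
      rw [two_nsmul]
      nth_rewrite 2 [h2]
      exact add_neg_cancel Tt
    have hdvd := addOrderOf_dvd_of_nsmul_eq_zero h0
    rw [hord] at hdvd
    exact absurd hdvd (by decide)
  have hnotneg : ¬ LineFrobeniusNegatesAt curve11A1 5 Φ 11 :=
    not_lineFrobeniusNegatesAt_of_forall_smul_eq htriv (AddSubgroup.mem_zmultiples Tt) hT2
      (by norm_num)
  refine h curve11A1 Φ 11 ?_ ⟨hcard, fun σ P hP => by rw [htriv σ P hP]; exact hP⟩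
    (lineOrderDvdTwo_of_forall_smul_eq htriv) (lineEven_of_forall_smul_eq htriv)
    (lineUnramifiedAt_of_forall_smul_eq htriv) ?_ numPrimesAbove_five_eleven ?_ ?_ ?_ ?_
  · rw [conductorNorm_curve11A1]; decide
  · rw [conductorNorm_curve11A1]
  · intro hA
    exact absurd hasMultiplicativeReductionAtPrime_curve11A1 hA.2
  · refine ⟨by rw [conductorNorm_curve11A1]; decide, fun ℓ hℓ hdvd hne => ?_⟩
    rw [conductorNorm_curve11A1] at hdvd
    exact absurd ((Nat.prime_dvd_prime_iff_eq hℓ (by norm_num)).mp hdvd) hne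
  · intro
    exact ⟨fun _ => by decide, fun hneg => absurd hneg hnotneg⟩
  · intro _ hns
    exact absurd hasSplitMultiplicativeReductionAtPrime_curve11A1 hns

/-- The same, read as: infinitely many `d` for which every global minimal model of the twist
`X₀(11)^{(d)}` has NON-DEGENERATE `5`-adic height pairing (and `rank = ord_{s=1} L = 1`).
[cite: BurungaleSkinner2023, Thm. 2.11 (pp. 23–24) and Example (E4) (p. 24)] -/
theorem infinitelyMany_twists_curve11A1_padicHeightNondegenerate [Fact (Nat.Prime 5)]
    [Fact (Nat.Prime 11)] (h : thm211_infinitelyMany_twists_rankOne_nondegenerate) :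
    {d : ℤ | IsOddQuadraticCharDiscr d ∧ (curve11A1.quadraticTwist (d : ℚ)).mordellWeilRank = 1 ∧
      (curve11A1.quadraticTwist (d : ℚ)).analyticRank = 1 ∧
      ∀ (W' : WeierstrassCurve ℚ) [W'.IsElliptic] [W'.IsGloballyMinimal] (C : VariableChange ℚ),
        C • curve11A1.quadraticTwist (d : ℚ) = W' → PAdicHeightNondegenerate W' 5}.Infinite := by
  refine (infinitelyMany_twists_curve11A1 h).mono fun d hd => ⟨hd.1, hd.2.1, hd.2.2.1, ?_⟩
  intro W' _ _ C hC
  exact (hd.2.2.2 W' C hC).2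

end Literature.NumberTheory.EllipticCurves.BurungaleSkinner2023

end
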